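import Mathlib.Analysis.SpecialFunctions.ImproperIntegrals
import Mathlib.Analysis.SpecialFunctions.Integrability.Basic
import Mathlib.Analysis.SpecialFunctions.Pow.NNReal
import Mathlib.MeasureTheory.Measure.Haar.InnerProductSpace
import Mathlib.Analysis.MeanInequalities
import Literature.Analysis.FluidPDE.PoincareBall
import Literature.Analysis.FluidPDE.AxisymmetricEuler
import HarnessLib

/-!
# KNSS 2009, proof of Theorem 6.2: the cylinder integral `I(M) → 0` of the vertex estimate

Analysis/FluidPDE support file (everything proved, no definitions) on the discharge path of
`Literature.Analysis.FluidPDE.KNSS2009_typeI_rate_vertex` (`KNSSTypeIRateCore.lean`; Koch–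
Nadirashvili–Seregin–Šverák, Acta Math. 203 (2009) = arXiv:0709.3599, proof of Theorem 6.2, last
paragraph, p. 13): "using the bound (wkbound2) together with the decay of the kernel (3.8), one
sees that it is enough to estimate the integral
`I(M) = ∫_{-1}^0 ∫ ∫_{|x'| ≤ M/2} (√(-τ) + |x'|/M)^{-2} (M²/4 + x₃²)^{-2} dx' dx₃ dτ` … An easy
calculation shows that `I(M) → 0` as `M → ∞`."

In the tree's coordinates (`ℝ³ = EuclideanSpace ℝ (Fin 3)`, vertical axis through
`c_M = -M e₁ = EuclideanSpace.single 0 (-M)`, `ρ_M(y) = cylRadius (y - c_M) = √((y₀+M)² + y₁²)`,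
cylinder `𝒞_M = {ρ_M ≤ M/2}`) the quantity that the vertex estimate at `x = 0` needs is

  `∫_{(-1,t)} ∫_{𝒞_M} (t - τ + ‖y‖²)^{-2} · M²/(M√(-τ) + ρ_M(y))² dy dτ`, `t ≤ 0`,

(the kernel decay (3.8), `|K(x,t)| ≤ C(|x|² + t)^{-2}` for `n = 3`, at `x - y = -y`, times the
square of (wkbound2), `|w| ≤ KM/(M√(-τ) + ρ_M)`). This file proves

* `setLIntegral_cylinder_vertexMajorant_le` — **it is at most `C₁/M`** for a universal `C₁`:
  on `𝒞_M` one has `y₀ ≤ -M/2`, so `(t - τ + ‖y‖²)^{-2} ≤ (M²/4 + y₂²)^{-2}`; the affine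
  substitution `y = c_M + M z` (`PoincareBall.lintegral_comp_smul_add`) turns the integral into `M⁻¹ J` with
  the *fixed* integral `J = ∫_{(-1,0)} ∫_{ρ(z) ≤ 1/2} (1/4 + z₂²)^{-2} (√(-τ) + ρ(z))^{-2} dz dτ`
  (this is the printed `I(M) = O(1/M)` computation, organised as scaling + finiteness);
* `lintegral_vertexJ_lt_top` — **`J < ∞`**: by weighted AM–GM, `(√(-τ) + ρ)^{-2} ≤
  (-τ)^{-3/4} ρ^{-1/2} ≤ (-τ)^{-3/4} |z₀|^{-1/2}`, and `{ρ ≤ 1/2} ⊆ {|z₀| ≤ 1/2} × {|z₁| ≤ 1/2} × ℝ`,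
  so `J ≤ (∫_{(0,1)} σ^{-3/4}) · ∫ |z₀|^{-1/2}1_{|z₀|≤1/2} · ∫ 1_{|z₁|≤1/2} · ∫ (1/4 + z₂²)^{-2} < ∞`
  (Tonelli over `ℝ³ ≃ ℝ × ℝ × ℝ`, `lintegral_euclidean_three_mul`; the singular factor is handled
  in `ℝ≥0∞`, where `0^{-1/2} = ⊤`, so that all pointwise bounds hold everywhere).

## Mathlib / tree search

Tree: `cylRadius`, `cylRadius_sq`, `cylRadius_nonneg` (`AxisymmetricEuler`); the affine
substitution `PoincareBall.lintegral_comp_smul_add` (`PoincareBall`); a general `ℝ≥0∞` Tonelli over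
`Fin n → Eᵢ` exists in `Literature.MathematicalPhysics.KineticTheory.HardSphereEulerProofs`
(`lintegral_fin_nat_prod_eq_prod`); only the three-factor case on `ℝ³` is needed and proved here,
to keep the kinetic-theory stack (Fernique, Gaussian laws) out of the import closure of the KNSS
files. Mathlib: `volume_preserving_piFinSuccAbove`, `volume_preserving_finTwoArrow`,
`lintegral_prod_mul`, `PiLp.volume_preserving_ofLp`,
`intervalIntegral.integrableOn_Ioo_rpow_iff`, `integrable_inv_one_add_sq`,
`Real.geom_mean_le_arith_mean2_weighted`, `ENNReal.zero_rpow_of_neg`, `ENNReal.ofReal_rpow_of_pos`.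

## References

* G. Koch, N. Nadirashvili, G. Seregin, V. Šverák, *Liouville theorems for the Navier–Stokes
  equations and applications*, Acta Math. 203 (2009) 83–105 = arXiv:0709.3599, proof of Thm 6.2,
  last paragraph (p. 13): the integral `I(M)`; §3 (3.8) (p. 6). [KochNadirashviliSereginSverak2009]
-/

noncomputable section

open MeasureTheory TopologicalSpace Set Function Filter Metric
open _root_.Topology
open scoped ENNReal NNReal

namespace Literature.Analysis.FluidPDE

/-! ### Tonelli on `ℝ³`, in `ℝ≥0∞` -/

section Tonelli

/-- Tonelli for a product of three one-variable factors on `Fin 3 → ℝ`: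
`∫ f₀(x₀) f₁(x₁) f₂(x₂) dx = (∫ f₀)((∫ f₁)(∫ f₂))` for measurable `fᵢ : ℝ → ℝ≥0∞` (split off the
first coordinate with `volume_preserving_piFinSuccAbove`, then `volume_preserving_finTwoArrow`,
and `lintegral_prod_mul` twice). [folklore] -/
theorem lintegral_pi_fin_three_mul (f₀ f₁ f₂ : ℝ → ℝ≥0∞) (h₀ : Measurable f₀) (h₁ : Measurable f₁)
    (h₂ : Measurable f₂) :
    ∫⁻ x : Fin 3 → ℝ, f₀ (x 0) * (f₁ (x 1) * f₂ (x 2)) =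
      (∫⁻ a, f₀ a) * ((∫⁻ a, f₁ a) * ∫⁻ a, f₂ a) := by
  -- the last two coordinates
  have h12 : ∫⁻ y : Fin 2 → ℝ, f₁ (y 0) * f₂ (y 1) = (∫⁻ a, f₁ a) * ∫⁻ a, f₂ a := by
    have e2 := volume_preserving_finTwoArrow ℝ
    rw [← lintegral_prod_mul h₁.aemeasurable h₂.aemeasurable, ← Measure.volume_eq_prod,
      ← e2.lintegral_comp_emb (MeasurableEquiv.measurableEmbedding _)]
    rfl
  have hm12 : Measurable fun y : Fin 2 → ℝ => f₁ (y 0) * f₂ (y 1) :=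
    (h₁.comp (measurable_pi_apply 0)).mul (h₂.comp (measurable_pi_apply 1))
  have e3 := volume_preserving_piFinSuccAbove (fun _ : Fin 3 => ℝ) 0
  rw [← h12, ← lintegral_prod_mul h₀.aemeasurable hm12.aemeasurable, ← Measure.volume_eq_prod,
    ← e3.lintegral_comp_emb (MeasurableEquiv.measurableEmbedding _)]
  rfl

/-- Tonelli on `ℝ³ = EuclideanSpace ℝ (Fin 3)`: for measurable `fᵢ : ℝ → ℝ≥0∞`,
`∫ f₀(z₀) f₁(z₁) f₂(z₂) dz = (∫ f₀)((∫ f₁)(∫ f₂))` (volume on `EuclideanSpace ℝ (Fin 3)` is the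
image of the product Lebesgue measure, `PiLp.volume_preserving_ofLp`). [folklore] -/
theorem lintegral_euclidean_three_mul (f₀ f₁ f₂ : ℝ → ℝ≥0∞) (h₀ : Measurable f₀)
    (h₁ : Measurable f₁) (h₂ : Measurable f₂) :
    ∫⁻ z : EuclideanSpace ℝ (Fin 3), f₀ (z 0) * (f₁ (z 1) * f₂ (z 2)) =
      (∫⁻ a, f₀ a) * ((∫⁻ a, f₁ a) * ∫⁻ a, f₂ a) := by
  have hm : Measurable fun x : Fin 3 → ℝ => f₀ (x 0) * (f₁ (x 1) * f₂ (x 2)) :=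
    (h₀.comp (measurable_pi_apply 0)).mul
      ((h₁.comp (measurable_pi_apply 1)).mul (h₂.comp (measurable_pi_apply 2)))
  have h := (PiLp.volume_preserving_ofLp (Fin 3)).lintegral_comp hm
  rw [show (fun z : EuclideanSpace ℝ (Fin 3) => f₀ (z 0) * (f₁ (z 1) * f₂ (z 2))) =
      fun z => (fun x : Fin 3 → ℝ => f₀ (x 0) * (f₁ (x 1) * f₂ (x 2))) (WithLp.ofLp z) from rfl, h,
    lintegral_pi_fin_three_mul f₀ f₁ f₂ h₀ h₁ h₂]

end Tonelli

/-! ### The three one-dimensional factors -/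

section OneDim

/-- `∫_{(0,1)} σ^{-3/4} dσ < ∞`. [folklore] -/
theorem lintegral_Ioo_rpow_neg_three_quarters_lt_top :
    ∫⁻ σ in Ioo (0 : ℝ) 1, ENNReal.ofReal (σ ^ (-(3 / 4 : ℝ))) < ⊤ := by
  have hint : IntegrableOn (fun σ : ℝ => σ ^ (-(3 / 4 : ℝ))) (Ioo 0 1) :=
    (intervalIntegral.integrableOn_Ioo_rpow_iff zero_lt_one).2 (by norm_num)
  exact lt_of_le_of_lt (lintegral_ofReal_le_lintegral_enorm _) hint.2

/-- The singular transverse factor: `∫_{[-1/2,1/2]} |a|^{-1/2} da < ∞`, with the `ℝ≥0∞` power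
(`0^{-1/2} = ⊤` at the single point `a = 0`). [folklore] -/
theorem lintegral_indicator_abs_rpow_neg_half_lt_top :
    ∫⁻ a : ℝ, (Icc (-(1 / 2 : ℝ)) (1 / 2)).indicator
        (fun a => (ENNReal.ofReal |a|) ^ (-(1 / 2 : ℝ))) a < ⊤ := by
  set g : ℝ → ℝ≥0∞ := fun a => (ENNReal.ofReal |a|) ^ (-(1 / 2 : ℝ)) with hg
  rw [lintegral_indicator measurableSet_Icc]
  -- `[-1/2, 1/2] ⊆ [-1/2, 0] ∪ [0, 1/2]`, and the two halves are mirror images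
  have hsplit : Icc (-(1 / 2 : ℝ)) (1 / 2) ⊆ Icc (-(1 / 2 : ℝ)) 0 ∪ Icc 0 (1 / 2) := by
    intro a ha
    rcases le_total a 0 with h | h
    · exact Or.inl ⟨ha.1, h⟩
    · exact Or.inr ⟨h, ha.2⟩
  have hpos : ∫⁻ a in Icc (0 : ℝ) (1 / 2), g a < ⊤ := by
    rw [← restrict_Ioo_eq_restrict_Icc]
    have heq : ∀ a ∈ Ioo (0 : ℝ) (1 / 2), g a = ENNReal.ofReal (a ^ (-(1 / 2 : ℝ))) := by
      intro a ha
      rw [hg]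
      dsimp only
      rw [abs_of_pos ha.1, ENNReal.ofReal_rpow_of_pos ha.1]
    rw [setLIntegral_congr_fun measurableSet_Ioo heq]
    have hint : IntegrableOn (fun σ : ℝ => σ ^ (-(1 / 2 : ℝ))) (Ioo 0 (1 / 2)) :=
      (intervalIntegral.integrableOn_Ioo_rpow_iff (by norm_num)).2 (by norm_num)
    exact lt_of_le_of_lt (lintegral_ofReal_le_lintegral_enorm _) hint.2
  have hneg : ∫⁻ a in Icc (-(1 / 2 : ℝ)) 0, g a = ∫⁻ a in Icc (0 : ℝ) (1 / 2), g a := by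
    have hmp : MeasurePreserving (fun a : ℝ => -a) volume volume :=
      Measure.measurePreserving_neg volume
    have hemb : MeasurableEmbedding (fun a : ℝ => -a) := (MeasurableEquiv.neg ℝ).measurableEmbedding
    have h := hmp.setLIntegral_comp_preimage_emb hemb g (Icc (-(1 / 2 : ℝ)) 0)
    have hpre : (fun a : ℝ => -a) ⁻¹' Icc (-(1 / 2 : ℝ)) 0 = Icc 0 (1 / 2) := by
      ext a; simp only [mem_preimage, mem_Icc]; constructor <;> intro h <;> constructor <;> linarith
    rw [hpre] at h
    rw [← h]
    refine setLIntegral_congr_fun measurableSet_Icc fun a _ => ?_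
    simp only [hg, abs_neg]
  calc ∫⁻ a in Icc (-(1 / 2 : ℝ)) (1 / 2), g a
      ≤ ∫⁻ a in Icc (-(1 / 2 : ℝ)) 0 ∪ Icc 0 (1 / 2), g a := lintegral_mono_set hsplit
    _ ≤ (∫⁻ a in Icc (-(1 / 2 : ℝ)) 0, g a) + ∫⁻ a in Icc (0 : ℝ) (1 / 2), g a :=
        lintegral_union_le _ _ _
    _ < ⊤ := by rw [hneg]; exact ENNReal.add_lt_top.2 ⟨hpos, hpos⟩

/-- The vertical factor: `∫ (1/4 + a²)^{-2} da < ∞` (compare with `16 (1 + a²)^{-1}`,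
`integrable_inv_one_add_sq`). [folklore] -/
theorem lintegral_inv_quarter_add_sq_sq_lt_top :
    ∫⁻ a : ℝ, ENNReal.ofReal (((1 / 4 + a ^ 2) ^ 2)⁻¹) < ⊤ := by
  have hint : Integrable (fun a : ℝ => 16 * (1 + a ^ 2)⁻¹) := integrable_inv_one_add_sq.const_mul 16
  have hle : ∀ a : ℝ, ((1 / 4 + a ^ 2) ^ 2)⁻¹ ≤ 16 * (1 + a ^ 2)⁻¹ := by
    intro a
    have h1 : 0 < 1 + a ^ 2 := by positivity
    have h2 : 0 < (1 / 4 + a ^ 2) ^ 2 := by positivity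
    rw [← div_eq_mul_inv, inv_le_comm₀ h2 (by positivity), inv_div]
    have : (1 + a ^ 2) / 16 ≤ (1 / 4 + a ^ 2) ^ 2 := by nlinarith [sq_nonneg a, sq_nonneg (a ^ 2)]
    exact this
  calc ∫⁻ a : ℝ, ENNReal.ofReal (((1 / 4 + a ^ 2) ^ 2)⁻¹)
      ≤ ∫⁻ a : ℝ, ENNReal.ofReal (16 * (1 + a ^ 2)⁻¹) :=
        lintegral_mono fun a => ENNReal.ofReal_le_ofReal (hle a)
    _ ≤ ∫⁻ a : ℝ, ‖16 * (1 + a ^ 2)⁻¹‖ₑ := lintegral_ofReal_le_lintegral_enorm _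
    _ < ⊤ := hint.2

end OneDim

/-! ### Pointwise bounds -/

section Pointwise

/-- **Weighted AM–GM form of the singular factor**: for `s > 0` and `0 ≤ b ≤ r`,
`(√s + r)^{-2} ≤ s^{-3/4} b^{-1/2}` in `ℝ≥0∞` (with `0^{-1/2} = ⊤`): indeed
`(√s)^{3/4} b^{1/4} ≤ ¾√s + ¼b ≤ √s + r` (`Real.geom_mean_le_arith_mean2_weighted`). [folklore] -/
theorem ofReal_inv_sqrt_add_sq_le {s b r : ℝ} (hs : 0 < s) (hb : 0 ≤ b) (hbr : b ≤ r) :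
    ENNReal.ofReal (((Real.sqrt s + r) ^ 2)⁻¹) ≤
      ENNReal.ofReal (s ^ (-(3 / 4 : ℝ))) * (ENNReal.ofReal b) ^ (-(1 / 2 : ℝ)) := by
  have hs34 : 0 < s ^ (-(3 / 4 : ℝ)) := Real.rpow_pos_of_pos hs _
  rcases hb.eq_or_lt with h | hb0
  · -- `b = 0`: the right-hand side is `⊤`
    rw [← h, ENNReal.ofReal_zero, ENNReal.zero_rpow_of_neg (by norm_num),
      ENNReal.mul_top (ENNReal.ofReal_pos.2 hs34).ne']
    exact le_top
  rw [ENNReal.ofReal_rpow_of_pos hb0, ← ENNReal.ofReal_mul hs34.le]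
  refine ENNReal.ofReal_le_ofReal ?_
  set A : ℝ := Real.sqrt s with hA
  have hA0 : 0 < A := Real.sqrt_pos.2 hs
  -- `A^{3/4} b^{1/4} ≤ A + r`
  have hamgm : A ^ (3 / 4 : ℝ) * b ^ (1 / 4 : ℝ) ≤ A + r := by
    have h := Real.geom_mean_le_arith_mean2_weighted (w₁ := 3 / 4) (w₂ := 1 / 4) (p₁ := A)
      (p₂ := b) (by norm_num) (by norm_num) hA0.le hb (by norm_num)
    linarith
  have hG0 : 0 < A ^ (3 / 4 : ℝ) * b ^ (1 / 4 : ℝ) := by positivity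
  -- square it: `s^{3/4} b^{1/2} ≤ (A + r)²`
  have hsq : (A ^ (3 / 4 : ℝ) * b ^ (1 / 4 : ℝ)) ^ 2 = s ^ (3 / 4 : ℝ) * b ^ (1 / 2 : ℝ) := by
    rw [mul_pow, ← Real.rpow_natCast (A ^ (3 / 4 : ℝ)) 2, ← Real.rpow_mul hA0.le,
      ← Real.rpow_natCast (b ^ (1 / 4 : ℝ)) 2, ← Real.rpow_mul hb, hA, Real.sqrt_eq_rpow,
      ← Real.rpow_mul hs.le]
    norm_num
  have hle : s ^ (3 / 4 : ℝ) * b ^ (1 / 2 : ℝ) ≤ (A + r) ^ 2 := by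
    rw [← hsq]
    exact pow_le_pow_left₀ hG0.le hamgm 2
  have hpos : 0 < s ^ (3 / 4 : ℝ) * b ^ (1 / 2 : ℝ) := by positivity
  calc ((A + r) ^ 2)⁻¹ ≤ (s ^ (3 / 4 : ℝ) * b ^ (1 / 2 : ℝ))⁻¹ := by
        rw [inv_le_inv₀ (hpos.trans_le hle) hpos]; exact hle
    _ = s ^ (-(3 / 4 : ℝ)) * b ^ (-(1 / 2 : ℝ)) := by
        rw [mul_inv, Real.rpow_neg hs.le, Real.rpow_neg hb]

/-- `|z₀| ≤ cylRadius z` (and symmetrically for `z₁`). [folklore] -/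
theorem abs_apply_zero_le_cylRadius (z : EuclideanSpace ℝ (Fin 3)) : |z 0| ≤ cylRadius z := by
  unfold cylRadius
  calc |z 0| = Real.sqrt ((z 0) ^ 2) := (Real.sqrt_sq_eq_abs _).symm
    _ ≤ Real.sqrt ((z 0) ^ 2 + (z 1) ^ 2) := Real.sqrt_le_sqrt (by nlinarith [sq_nonneg (z 1)])

/-- `|z₁| ≤ cylRadius z`. [folklore] -/
theorem abs_apply_one_le_cylRadius (z : EuclideanSpace ℝ (Fin 3)) : |z 1| ≤ cylRadius z := by
  unfold cylRadius
  calc |z 1| = Real.sqrt ((z 1) ^ 2) := (Real.sqrt_sq_eq_abs _).symm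
    _ ≤ Real.sqrt ((z 0) ^ 2 + (z 1) ^ 2) := Real.sqrt_le_sqrt (by nlinarith [sq_nonneg (z 0)])

/-- **The cylinder lies in the half-space `y₀ ≤ -M/2`, far from the vertex**: if
`cylRadius (y - c_M) ≤ M/2` with `c_M = EuclideanSpace.single 0 (-M)`, then
`M²/4 + y₂² ≤ ‖y‖²` (KNSS 2009, p. 13: the factor `(M²/4 + x₃²)^{-2}` of `I(M)`). [cite: KochNadirashviliSereginSverak2009, proof of Thm 6.2, last paragraph (arXiv p. 13)] -/
theorem sq_div_four_add_sq_le_norm_sq_of_mem_cylinder {M : ℝ} (hM : 0 < M) {y : EuclideanSpace ℝ (Fin 3)}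
    (hy : cylRadius (y - EuclideanSpace.single 0 (-M)) ≤ M / 2) :
    M ^ 2 / 4 + (y 2) ^ 2 ≤ ‖y‖ ^ 2 := by
  have h0 : |(y - EuclideanSpace.single 0 (-M) : EuclideanSpace ℝ (Fin 3)) 0| ≤ M / 2 :=
    (abs_apply_zero_le_cylRadius _).trans hy
  have e0 : (y - EuclideanSpace.single 0 (-M) : EuclideanSpace ℝ (Fin 3)) 0 = y 0 + M := by simp
  rw [e0] at h0
  have hy0 : y 0 ≤ -(M / 2) := by linarith [(abs_le.1 h0).2]
  have hsq : M ^ 2 / 4 ≤ (y 0) ^ 2 := by nlinarith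
  rw [EuclideanSpace.real_norm_sq_eq, Fin.sum_univ_three]
  nlinarith [sq_nonneg (y 1)]

/-- **The majorant of the vertex integrand on the cylinder**: for `M > 0`, `τ < t ≤ 0` and
`y ∈ 𝒞_M`, `(t - τ + ‖y‖²)^{-2} · M²/(M√(-τ) + ρ_M(y))² ≤ (M²/4 + y₂²)^{-2} · (√(-τ) + ρ_M(y)/M)^{-2}`
(in `ℝ≥0∞`). [cite: KochNadirashviliSereginSverak2009, proof of Thm 6.2, last paragraph (arXiv p. 13)] -/
theorem vertexIntegrand_le_of_mem_cylinder {M : ℝ} (hM : 0 < M) {t τ : ℝ} (hτt : τ < t)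
    (ht : t ≤ 0) {y : EuclideanSpace ℝ (Fin 3)} (hy : cylRadius (y - EuclideanSpace.single 0 (-M)) ≤ M / 2) :
    ENNReal.ofReal (((t - τ + ‖y‖ ^ 2) ^ 2)⁻¹) *
        ENNReal.ofReal (M ^ 2 / (M * Real.sqrt (-τ) + cylRadius (y - EuclideanSpace.single 0 (-M))) ^ 2) ≤
      ENNReal.ofReal (((M ^ 2 / 4 + (y 2) ^ 2) ^ 2)⁻¹) *
        ENNReal.ofReal (((Real.sqrt (-τ) + cylRadius (y - EuclideanSpace.single 0 (-M)) / M) ^ 2)⁻¹) := by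
  set ρ : ℝ := cylRadius (y - EuclideanSpace.single 0 (-M)) with hρ
  have hρ0 : 0 ≤ ρ := cylRadius_nonneg _
  have hsqrt : 0 < Real.sqrt (-τ) := Real.sqrt_pos.2 (by linarith)
  have hgeom := sq_div_four_add_sq_le_norm_sq_of_mem_cylinder hM hy
  have hq0 : 0 < M ^ 2 / 4 + (y 2) ^ 2 := by positivity
  refine mul_le_mul' (ENNReal.ofReal_le_ofReal ?_) (ENNReal.ofReal_le_ofReal (le_of_eq ?_))
  · rw [inv_le_inv₀ (by positivity) (by positivity)]
    exact pow_le_pow_left₀ hq0.le (by linarith) 2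
  · have hden : (M * Real.sqrt (-τ) + ρ) ^ 2 = M ^ 2 * (Real.sqrt (-τ) + ρ / M) ^ 2 := by
      field_simp
    rw [hden, div_mul_eq_div_div, div_self (by positivity), one_div]

end Pointwise

/-! ### The fixed integral `J` is finite -/

section Finite

/-- The unit picture of the cylinder, `{z : cylRadius z ≤ 1/2}`, is a closed, hence measurable,
set. [folklore] -/
theorem measurableSet_cylRadius_le (a : ℝ) : MeasurableSet {z : EuclideanSpace ℝ (Fin 3) | cylRadius z ≤ a} :=
  (isClosed_le continuous_cylRadius continuous_const).measurableSet

/-- **`J < ∞`**: the fixed integral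
`J = ∫_{(-1,0)} ∫_{cylRadius z ≤ 1/2} (1/4 + z₂²)^{-2} (√(-τ) + cylRadius z)^{-2} dz dτ` of the
scaled vertex majorant is finite (weighted AM–GM `(√(-τ) + ρ)^{-2} ≤ (-τ)^{-3/4}|z₀|^{-1/2}`, the
box `{|z₀| ≤ 1/2} × {|z₁| ≤ 1/2} × ℝ ⊇ {ρ ≤ 1/2}`, Tonelli, and the three one-dimensional
factors). This is the content of "an easy calculation shows that `I(M) → 0`" (KNSS 2009, p. 13),
the rate `1/M` coming from scaling (`setLIntegral_cylinder_vertexMajorant_le`). [cite: KochNadirashviliSereginSverak2009, proof of Thm 6.2, last paragraph (arXiv p. 13)] -/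
theorem lintegral_vertexJ_lt_top :
    ∫⁻ τ in Ioo (-1 : ℝ) 0, ∫⁻ z in {z : EuclideanSpace ℝ (Fin 3) | cylRadius z ≤ 1 / 2},
      ENNReal.ofReal (((1 / 4 + (z 2) ^ 2) ^ 2)⁻¹) *
        ENNReal.ofReal (((Real.sqrt (-τ) + cylRadius z) ^ 2)⁻¹) < ⊤ := by
  set C₁ : Set (EuclideanSpace ℝ (Fin 3)) := {z | cylRadius z ≤ 1 / 2} with hC₁
  have hC₁m : MeasurableSet C₁ := measurableSet_cylRadius_le _
  -- the three one-dimensional factors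
  set f₀ : ℝ → ℝ≥0∞ := fun a => (Icc (-(1 / 2 : ℝ)) (1 / 2)).indicator
    (fun a => (ENNReal.ofReal |a|) ^ (-(1 / 2 : ℝ))) a with hf₀
  set f₁ : ℝ → ℝ≥0∞ := fun a => (Icc (-(1 / 2 : ℝ)) (1 / 2)).indicator 1 a with hf₁
  set f₂ : ℝ → ℝ≥0∞ := fun a => ENNReal.ofReal (((1 / 4 + a ^ 2) ^ 2)⁻¹) with hf₂
  have hf₀m : Measurable f₀ := by
    refine Measurable.indicator ?_ measurableSet_Icc
    exact (continuous_abs.measurable.ennreal_ofReal).pow_const _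
  have hf₁m : Measurable f₁ := measurable_one.indicator measurableSet_Icc
  have hf₂m : Measurable f₂ := by
    refine ENNReal.measurable_ofReal.comp ?_
    exact ((continuous_const.add (continuous_pow 2)).pow 2).measurable.inv
  -- finiteness of the product of the factors
  have hP : ∫⁻ z : EuclideanSpace ℝ (Fin 3), f₀ (z 0) * (f₁ (z 1) * f₂ (z 2)) < ⊤ := by
    rw [lintegral_euclidean_three_mul f₀ f₁ f₂ hf₀m hf₁m hf₂m]
    refine ENNReal.mul_lt_top ?_ (ENNReal.mul_lt_top ?_ ?_)
    · exact lintegral_indicator_abs_rpow_neg_half_lt_top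
    · rw [hf₁, lintegral_indicator measurableSet_Icc]
      simp
    · exact lintegral_inv_quarter_add_sq_sq_lt_top
  -- the pointwise bound on the spatial integrand, for fixed `τ ∈ (-1, 0)`
  have hspace : ∀ τ ∈ Ioo (-1 : ℝ) 0,
      ∫⁻ z in C₁, ENNReal.ofReal (((1 / 4 + (z 2) ^ 2) ^ 2)⁻¹) *
          ENNReal.ofReal (((Real.sqrt (-τ) + cylRadius z) ^ 2)⁻¹) ≤
        ENNReal.ofReal ((-τ) ^ (-(3 / 4 : ℝ))) *
          ∫⁻ z : EuclideanSpace ℝ (Fin 3), f₀ (z 0) * (f₁ (z 1) * f₂ (z 2)) := by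
    intro τ hτ
    have hs : 0 < -τ := by linarith [hτ.2]
    rw [← lintegral_indicator hC₁m, ← lintegral_const_mul' _ _ ENNReal.ofReal_ne_top]
    refine lintegral_mono fun z => ?_
    by_cases hz : z ∈ C₁
    · rw [indicator_of_mem hz]
      have hzρ : cylRadius z ≤ 1 / 2 := hz
      have hz0 : z 0 ∈ Icc (-(1 / 2 : ℝ)) (1 / 2) :=
        abs_le.1 ((abs_apply_zero_le_cylRadius z).trans hzρ) |> fun h => ⟨h.1, h.2⟩
      have hz1 : z 1 ∈ Icc (-(1 / 2 : ℝ)) (1 / 2) :=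
        abs_le.1 ((abs_apply_one_le_cylRadius z).trans hzρ) |> fun h => ⟨h.1, h.2⟩
      rw [hf₀, hf₁, hf₂]
      dsimp only
      rw [indicator_of_mem hz0, indicator_of_mem hz1, Pi.one_apply]
      have hkey := ofReal_inv_sqrt_add_sq_le hs (abs_nonneg (z 0)) (abs_apply_zero_le_cylRadius z)
      calc ENNReal.ofReal (((1 / 4 + (z 2) ^ 2) ^ 2)⁻¹) *
            ENNReal.ofReal (((Real.sqrt (-τ) + cylRadius z) ^ 2)⁻¹)
          ≤ ENNReal.ofReal (((1 / 4 + (z 2) ^ 2) ^ 2)⁻¹) *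
            (ENNReal.ofReal ((-τ) ^ (-(3 / 4 : ℝ))) * (ENNReal.ofReal |z 0|) ^ (-(1 / 2 : ℝ))) :=
            mul_le_mul' le_rfl hkey
        _ = ENNReal.ofReal ((-τ) ^ (-(3 / 4 : ℝ))) *
            ((ENNReal.ofReal |z 0|) ^ (-(1 / 2 : ℝ)) * (1 * ENNReal.ofReal (((1 / 4 + (z 2) ^ 2) ^ 2)⁻¹))) := by
            ring
    · rw [indicator_of_notMem hz]
      exact zero_le
  -- the time factor
  have htime : ∫⁻ τ in Ioo (-1 : ℝ) 0, ENNReal.ofReal ((-τ) ^ (-(3 / 4 : ℝ))) < ⊤ := by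
    have hmp : MeasurePreserving (fun a : ℝ => -a) volume volume :=
      Measure.measurePreserving_neg volume
    have hemb : MeasurableEmbedding (fun a : ℝ => -a) := (MeasurableEquiv.neg ℝ).measurableEmbedding
    have h := hmp.setLIntegral_comp_preimage_emb hemb
      (fun σ => ENNReal.ofReal (σ ^ (-(3 / 4 : ℝ)))) (Ioo 0 1)
    have hpre : (fun a : ℝ => -a) ⁻¹' Ioo (0 : ℝ) 1 = Ioo (-1) 0 := by
      ext a; simp only [mem_preimage, mem_Ioo]; constructor <;> intro h <;> constructor <;> linarith
    rw [hpre] at h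
    rw [h]
    exact lintegral_Ioo_rpow_neg_three_quarters_lt_top
  -- assemble
  calc ∫⁻ τ in Ioo (-1 : ℝ) 0, ∫⁻ z in C₁, ENNReal.ofReal (((1 / 4 + (z 2) ^ 2) ^ 2)⁻¹) *
          ENNReal.ofReal (((Real.sqrt (-τ) + cylRadius z) ^ 2)⁻¹)
      ≤ ∫⁻ τ in Ioo (-1 : ℝ) 0, ENNReal.ofReal ((-τ) ^ (-(3 / 4 : ℝ))) *
          ∫⁻ z : EuclideanSpace ℝ (Fin 3), f₀ (z 0) * (f₁ (z 1) * f₂ (z 2)) :=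
        setLIntegral_mono' measurableSet_Ioo hspace
    _ = (∫⁻ τ in Ioo (-1 : ℝ) 0, ENNReal.ofReal ((-τ) ^ (-(3 / 4 : ℝ)))) *
          ∫⁻ z : EuclideanSpace ℝ (Fin 3), f₀ (z 0) * (f₁ (z 1) * f₂ (z 2)) :=
        lintegral_mul_const' _ _ hP.ne
    _ < ⊤ := ENNReal.mul_lt_top htime hP

end Finite

/-! ### Scaling: the cylinder integral is `O(1/M)` -/

section Scaling

/-- The cylinder `𝒞_M = {cylRadius (· - c_M) ≤ M/2}` is measurable. [folklore] -/
theorem measurableSet_cylinder (M : ℝ) :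
    MeasurableSet {y : EuclideanSpace ℝ (Fin 3) | cylRadius (y - EuclideanSpace.single 0 (-M)) ≤ M / 2} :=
  (isClosed_le (continuous_cylRadius.comp (continuous_sub_right _)) continuous_const).measurableSet

/-- **The affine substitution `y = c_M + M z`** on the scaled majorant: for `M > 0` and `τ < 0`,
`∫_{𝒞_M} (M²/4 + y₂²)^{-2} (√(-τ) + ρ_M(y)/M)^{-2} dy = M⁻¹ ∫_{cylRadius z ≤ 1/2} (1/4 + z₂²)^{-2}
(√(-τ) + cylRadius z)^{-2} dz` (Jacobian `M³`, the integrand scales by `M⁻⁴`). [cite: KochNadirashviliSereginSverak2009, proof of Thm 6.2, last paragraph (arXiv p. 13)] -/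
theorem setLIntegral_cylinder_scaled_eq {M : ℝ} (hM : 0 < M) (τ : ℝ) :
    ∫⁻ y in {y : EuclideanSpace ℝ (Fin 3) | cylRadius (y - EuclideanSpace.single 0 (-M)) ≤ M / 2},
        ENNReal.ofReal (((M ^ 2 / 4 + (y 2) ^ 2) ^ 2)⁻¹) *
          ENNReal.ofReal (((Real.sqrt (-τ) + cylRadius (y - EuclideanSpace.single 0 (-M)) / M) ^ 2)⁻¹) =
      ENNReal.ofReal M⁻¹ * ∫⁻ z in {z : EuclideanSpace ℝ (Fin 3) | cylRadius z ≤ 1 / 2},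
        ENNReal.ofReal (((1 / 4 + (z 2) ^ 2) ^ 2)⁻¹) *
          ENNReal.ofReal (((Real.sqrt (-τ) + cylRadius z) ^ 2)⁻¹) := by
  set c : EuclideanSpace ℝ (Fin 3) := EuclideanSpace.single 0 (-M) with hc
  set CM : Set (EuclideanSpace ℝ (Fin 3)) := {y | cylRadius (y - c) ≤ M / 2} with hCM
  set C₁ : Set (EuclideanSpace ℝ (Fin 3)) := {z | cylRadius z ≤ 1 / 2} with hC₁
  set G : EuclideanSpace ℝ (Fin 3) → ℝ≥0∞ := fun y => ENNReal.ofReal (((M ^ 2 / 4 + (y 2) ^ 2) ^ 2)⁻¹) *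
    ENNReal.ofReal (((Real.sqrt (-τ) + cylRadius (y - c) / M) ^ 2)⁻¹) with hG
  set F : EuclideanSpace ℝ (Fin 3) → ℝ≥0∞ := fun z => ENNReal.ofReal (((1 / 4 + (z 2) ^ 2) ^ 2)⁻¹) *
    ENNReal.ofReal (((Real.sqrt (-τ) + cylRadius z) ^ 2)⁻¹) with hF
  have hM0 : M ≠ 0 := hM.ne'
  -- the substituted integrand
  have hsub : ∀ z : EuclideanSpace ℝ (Fin 3), CM.indicator G (M • z + c) = ENNReal.ofReal (M ^ 4)⁻¹ * C₁.indicator F z := by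
    intro z
    have e1 : M • z + c - c = M • z := add_sub_cancel_right _ _
    have e2 : cylRadius (M • z + c - c) = M * cylRadius z := by
      rw [e1, cylRadius_smul, abs_of_pos hM]
    have e3 : (M • z + c) 2 = M * z 2 := by simp [hc]
    have hmem : (M • z + c ∈ CM) ↔ z ∈ C₁ := by
      change cylRadius (M • z + c - c) ≤ M / 2 ↔ cylRadius z ≤ 1 / 2
      rw [e2]
      constructor <;> intro h <;> nlinarith
    by_cases hz : z ∈ C₁
    · rw [indicator_of_mem (hmem.2 hz), indicator_of_mem hz, hG, hF]
      dsimp only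
      rw [e2, e3, mul_div_cancel_left₀ _ hM0]
      have hq : ((M ^ 2 / 4 + (M * z 2) ^ 2) ^ 2)⁻¹ = (M ^ 4)⁻¹ * ((1 / 4 + (z 2) ^ 2) ^ 2)⁻¹ := by
        rw [← mul_inv]
        congr 1
        ring
      rw [hq, ENNReal.ofReal_mul (by positivity), mul_assoc]
    · rw [indicator_of_notMem (fun h => hz (hmem.1 h)), indicator_of_notMem hz, mul_zero]
  -- the substitution
  have hcov := PoincareBall.lintegral_comp_smul_add (CM.indicator G) hM0 c
  have hfin : Module.finrank ℝ (EuclideanSpace ℝ (Fin 3)) = 3 := finrank_euclideanSpace_fin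
  rw [hfin] at hcov
  simp_rw [hsub] at hcov
  rw [lintegral_const_mul' _ _ ENNReal.ofReal_ne_top, lintegral_indicator (measurableSet_cylRadius_le _),
    lintegral_indicator (measurableSet_cylinder M), abs_of_pos (by positivity : (0 : ℝ) < (M ^ 3)⁻¹)] at hcov
  -- solve for `∫ G` : multiply by `M³`
  have hM3 : ENNReal.ofReal (M ^ 3) * ENNReal.ofReal (M ^ 3)⁻¹ = 1 := by
    rw [← ENNReal.ofReal_mul (by positivity), mul_inv_cancel₀ (by positivity), ENNReal.ofReal_one]
  calc ∫⁻ y in CM, G y = ENNReal.ofReal (M ^ 3) * (ENNReal.ofReal (M ^ 3)⁻¹ * ∫⁻ y in CM, G y) := by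
        rw [← mul_assoc, hM3, one_mul]
    _ = ENNReal.ofReal (M ^ 3) * (ENNReal.ofReal (M ^ 4)⁻¹ * ∫⁻ z in C₁, F z) := by rw [hcov]
    _ = ENNReal.ofReal M⁻¹ * ∫⁻ z in C₁, F z := by
        rw [← mul_assoc, ← ENNReal.ofReal_mul (by positivity)]
        congr 2
        field_simp

/-- **The cylinder contribution to the vertex is `O(1/M)`** (KNSS 2009, proof of Thm 6.2, last
paragraph: "it is enough to estimate the integral `I(M)` … `I(M) → 0` as `M → ∞`"). There is a
universal `C₁ > 0` such that for every `M > 0` and `t ≤ 0`,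
`∫_{(-1,t)} ∫_{𝒞_M} (t - τ + ‖y‖²)^{-2} · M²/(M√(-τ) + ρ_M(y))² dy dτ ≤ C₁/M`, where
`𝒞_M = {ρ_M ≤ M/2}`, `ρ_M(y) = cylRadius (y - c_M)`, `c_M = EuclideanSpace.single 0 (-M)`: the
kernel decay (3.8) at the vertex `x = 0` against the square of the bound (wkbound2) over the
cylinder. [cite: KochNadirashviliSereginSverak2009, proof of Thm 6.2, last paragraph (arXiv p. 13)] -/
theorem setLIntegral_cylinder_vertexMajorant_le :
    ∃ C₁ : ℝ, 0 < C₁ ∧ ∀ ⦃M : ℝ⦄, 0 < M → ∀ ⦃t : ℝ⦄, t ≤ 0 →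
      ∫⁻ τ in Ioo (-1 : ℝ) t, ∫⁻ y in {y : EuclideanSpace ℝ (Fin 3) | cylRadius (y - EuclideanSpace.single 0 (-M)) ≤ M / 2},
        ENNReal.ofReal (((t - τ + ‖y‖ ^ 2) ^ 2)⁻¹) *
          ENNReal.ofReal (M ^ 2 / (M * Real.sqrt (-τ) + cylRadius (y - EuclideanSpace.single 0 (-M))) ^ 2) ≤
        ENNReal.ofReal (C₁ / M) := by
  set J : ℝ≥0∞ := ∫⁻ τ in Ioo (-1 : ℝ) 0, ∫⁻ z in {z : EuclideanSpace ℝ (Fin 3) | cylRadius z ≤ 1 / 2},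
      ENNReal.ofReal (((1 / 4 + (z 2) ^ 2) ^ 2)⁻¹) *
        ENNReal.ofReal (((Real.sqrt (-τ) + cylRadius z) ^ 2)⁻¹) with hJ
  have hJfin : J < ⊤ := lintegral_vertexJ_lt_top
  refine ⟨J.toReal + 1, by positivity, fun M hM t ht => ?_⟩
  set c : EuclideanSpace ℝ (Fin 3) := EuclideanSpace.single 0 (-M) with hc
  set CM : Set (EuclideanSpace ℝ (Fin 3)) := {y | cylRadius (y - c) ≤ M / 2} with hCM
  have hCMm : MeasurableSet CM := measurableSet_cylinder M
  calc ∫⁻ τ in Ioo (-1 : ℝ) t, ∫⁻ y in CM, ENNReal.ofReal (((t - τ + ‖y‖ ^ 2) ^ 2)⁻¹) *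
          ENNReal.ofReal (M ^ 2 / (M * Real.sqrt (-τ) + cylRadius (y - c)) ^ 2)
      ≤ ∫⁻ τ in Ioo (-1 : ℝ) t, ∫⁻ y in CM, ENNReal.ofReal (((M ^ 2 / 4 + (y 2) ^ 2) ^ 2)⁻¹) *
          ENNReal.ofReal (((Real.sqrt (-τ) + cylRadius (y - c) / M) ^ 2)⁻¹) :=
        setLIntegral_mono' measurableSet_Ioo fun τ hτ =>
          setLIntegral_mono' hCMm fun y hy => vertexIntegrand_le_of_mem_cylinder hM hτ.2 ht hy
    _ ≤ ∫⁻ τ in Ioo (-1 : ℝ) 0, ∫⁻ y in CM, ENNReal.ofReal (((M ^ 2 / 4 + (y 2) ^ 2) ^ 2)⁻¹) *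
          ENNReal.ofReal (((Real.sqrt (-τ) + cylRadius (y - c) / M) ^ 2)⁻¹) :=
        lintegral_mono_set (Ioo_subset_Ioo_right ht)
    _ = ∫⁻ τ in Ioo (-1 : ℝ) 0, ENNReal.ofReal M⁻¹ * ∫⁻ z in {z : EuclideanSpace ℝ (Fin 3) | cylRadius z ≤ 1 / 2},
          ENNReal.ofReal (((1 / 4 + (z 2) ^ 2) ^ 2)⁻¹) *
            ENNReal.ofReal (((Real.sqrt (-τ) + cylRadius z) ^ 2)⁻¹) :=
        lintegral_congr fun τ => setLIntegral_cylinder_scaled_eq hM τ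
    _ = ENNReal.ofReal M⁻¹ * J := lintegral_const_mul' _ _ ENNReal.ofReal_ne_top
    _ ≤ ENNReal.ofReal M⁻¹ * ENNReal.ofReal (J.toReal + 1) := by
        gcongr
        calc J = ENNReal.ofReal J.toReal := (ENNReal.ofReal_toReal hJfin.ne).symm
          _ ≤ ENNReal.ofReal (J.toReal + 1) := ENNReal.ofReal_le_ofReal (by linarith)
    _ = ENNReal.ofReal ((J.toReal + 1) / M) := by
        rw [← ENNReal.ofReal_mul (by positivity)]
        congr 1
        field_simp

end Scaling


end Literature.Analysis.FluidPDE

end
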